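import Summits.AtomisticToContinuum.Crystallization.Theorems.FluxTubeKeplerFloorGivesLayered
import Summits.AtomisticToContinuum.Crystallization.Theorems.FluxTubeKeplerFluxCellKeplerSingleScale
import Summits.AtomisticToContinuum.Crystallization.Theorems.ChessboardParticlePlanesPeriodicWindowsIffCrystallization
import Summits.AtomisticToContinuum.Crystallization.Theorems.ReggeStarCoercivityStarCoercivitySeparationRemoval

/-!
# G27 — the HOLE-BLIND rung `HoleBlindRung` over `FluxTubeKepler.FloorGivesLayered`: typed AND PROVED (sorry-free)

Forward generator G1 (gen 27), seed `g1-AtomisticToContinuum-15223` =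
`FluxTubeKeplerFloorGivesLayered.FloorGivesLayered_proof` (the FLOOR), crux dir `FluxCellKepler`
(stmt-AtomisticToContinuum-15221).  OUTCOME OF THE SEAT: `found-nothing` — the one typed candidate of the
seat, `HoleBlindRung`, turned out to be a THEOREM and is proved outright in this file
(`holeBlindRung_holds`, axioms `propext, Classical.choice, Quot.sound`); it is therefore COSTUME in the
sense of `Lines/G26FoundNothing.md` (provable with the tree's means; see §Costume for the in-tree pricing
that closes the same dial at every `N`) and gives the open crux `FluxCellKepler` ZERO RELIEF (§Relief).
It is NOT a registered line (nothing is open).  The durable content is §Softness: two small structural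
facts about Lennard-Jones ground states that are NOT in the tree — `chemPotFrequentlyHigh` and
`noDeepHolesFrequently` (vacancy-free ground states for infinitely many particle numbers) — proved here;
a prover may port this file verbatim to `Theorems/` (`--supports stmt-AtomisticToContinuum-15221`).

THE DIAL.  FLOOR(P₀) (`N·e(P₀) ≤ E(x)` on Lennard-Jones ground states) + BUDGET(P₀) (at every scale
`(R, η)` some `c > 0` with `c · #{(R, η)-bad sites} ≤ E(x) − N·e(P₀)`) ⇒ periodic windows along every
ground-state sequence.  Here the budget is HOLE-BLIND with dial `(D, r)`: an `(R, η)`-bad site `i` is NOT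
priced when some EMPTY point `y ∉ x` within distance `r` of `x i` is a hole of depth `≥ D` for the
test-particle energy `f_x(y) = Σ_j V(|y − x_j|)` (`testEnergy`), i.e. `f_x(y) ≤ −D` (`NearDeepHole`).
Sites next to a VACANCY of near-optimal material (`f ≈ 2e⋆ ≈ −1.43`), next to a surface vacancy
(`f ≈ −1.0`) or next to any deep cavity go free, WHATEVER their own neighbourhood looks like (layered or
not) — not gen 2's class (`VacancyBlindRung`: one-way-layered-good sites) nor gen 21's (`SparseBlindRung`:
under-crowded sites).  Radius `r ≤ 0` un-prices nothing: `HoleRung D r` for `r ≤ 0` IS the floor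
(`holeRung_of_radius_nonpos`, F3).  Monotone: raising `r` or lowering `D` un-prices more
(`holeRung_anti_radius`, `holeRung_mono_depth`).  The candidate: `HoleBlindRung := ∀ D > −e⋆, HoleRung D 2`
— "a certificate that never looks within distance 2 of a hole deeper than the ground-state energy per
particle `|e⋆|` already forces periodic windows".  PROVED: `holeRung_holds : −e⋆ < D → HoleRung D r`
(every `r`), `holeBlindRung_holds : HoleBlindRung`.

ON PATH (F4): `Crystallization → HoleRung D r` for every `D, r` (`holeRung_of_crystallization`), hence
`HoleBlindRung_of_Crystallization` (moot now that the rung is a theorem, kept for the record).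

§Softness (the proof, all in this file).  INSERTION STABILITY (`insertion_le`, from the landed removal
identity `separationRemoval_interactionEnergy_succAbove`): for an `n`-particle ground state `x` and any
`y ∉ x`, `E(n+1) − E(n) ≤ f_x(y)`.  CHEMICAL-POTENTIAL DENSITY (`chemPotFrequentlyHigh`): for every
`θ > 0`, frequently in `n`, `E(n+1) − E(n) ≥ e⋆ − θ` — if eventually `E(n+1) − E(n) < e⋆ − θ`, telescoping
over `[N, 2N)` gives `E(2N) − E(N) ≤ N(e⋆ − θ)`, against `2N·e⋆ ≤ E(2N)` (`eStar_le_groundStateEnergy_div`)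
and `E(N) < N(e⋆ + θ/2)` eventually (`crysEnergyLimit`).  Together (`noDeepHolesFrequently`): for every
`θ > 0`, frequently in `n`, NO `n`-particle ground state has an empty point where a test particle would be
bound by more than `|e⋆| + θ` — in particular (kink sites bind by `≈ |e⋆|`, surface vacancies by `≈ 1.0`,
bulk vacancies by `≈ 1.4`) the ground states are free of bulk AND surface vacancies for infinitely many
`n`.  For `D > −e⋆` take `θ := (D + e⋆)/2`: on those `n` the hole-blind budget is the full budget, and the
floor's own method along that frequent set (`subsequenceFloor` = the seed's proof with Step 1 read through
`eventually_exists_not_bad` for the predicate `N ∈ S ∧ ¬LayeredGood`, Steps 2–3 verbatim) gives the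
windows (`holeRung_of`).

§Costume (why this is not a line).  The same dial is closed AT EVERY `N` by the tree already: the
insertion principle and "particles near deep holes pay" of
`Theorems/PhononSlackCertificatesNearFarGlueRHoles.lean` (`insertion_principle`, `holes_gap_of_floor`,
`holes_gap_near_of_floor` with `B := −e⋆`, `g := D + e⋆`, plus `exists_separated_net` /
`holes_gap_near_finset` and the minimal distance of ground states) give
`(D + e⋆)/(2(r + 9/10)/δ + 1)³ · #{sites within r of a hole of depth ≥ D} ≤ E(x) − N·e⋆` on every
ground state, so the hole-blind budget plus that pricing is the floor's BUDGET and `FloorGivesLayered_proof`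
applies verbatim.  Either way `HoleBlindRung` needs no idea beyond the tree: found-nothing (G26 sense).
Below `|e⋆|` (shallow holes: pores, loose packing, foam) no free pricing exists and the dial becomes the
registered vacancy / sparse lines (gens 2, 21).

§Relief (zero).  A site adjacent to a deep hole is UNDER-coordinated on the hole's side; the hard stars
of `FluxCellKepler`'s KEPLER inequality (icosahedral / over-packed, `TetrahedralFrustration`,
`KissingTwelveDegeneracy`) contain no empty point with `f ≤ −|e⋆|` nearby (they are over-dense), so every
one of them stays priced (G22 category (ii) "soft LJ exclusions ⇒ zero relief").  The mirror statement
(removal at the frequent `n` with `E(n) − E(n−1) ≤ e⋆ + θ`: every particle bound by `≥ |e⋆| − θ`) also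
constrains under-binding only.
-/

noncomputable section

namespace Summit.AtomisticToContinuum.Crystallization.Cruxes.FluxCellKepler.HoleLadder

open Filter Topology
open Literature.MathematicalPhysics.StatisticalMechanics
open Summit.AtomisticToContinuum.Crystallization.Theorems.FluxCellKeplerSingleScale (LayeredGood)
open Summit.AtomisticToContinuum.Crystallization.Theorems.ChargedEnergyGapNegative (eStar)
open Summit.AtomisticToContinuum.Crystallization.Theorems.FluxTubeKeplerFloorGivesLayered
  (eventually_exists_not_bad match_dilate layered_pt_scale spacing_selection)

local notation "E3" => EuclideanSpace ℝ (Fin 3)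

/-! ## The graded family -/

/-- FLOOR(P₀): `N·e(P₀) ≤ E(x)` for every Lennard-Jones ground state `x` (verbatim the first hypothesis
of `FluxTubeKepler.FloorGivesLayered`). -/
def Floor (P₀ : PeriodicConfiguration 3) : Prop :=
  ∀ (N : ℕ) (x : Fin N → E3), IsGroundState lennardJones x →
    (N : ℝ) * P₀.energyPerParticle lennardJones ≤ interactionEnergy lennardJones x

/-- The TEST-PARTICLE energy `f_x(y) = Σ_j V_LJ(|y − x_j|)` of an extra particle at `y`. -/
def testEnergy {N : ℕ} (x : Fin N → E3) (y : E3) : ℝ :=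
  ∑ j, lennardJones (dist y (x j))

/-- Site `i` of `x` lies within distance `r` of a HOLE OF DEPTH `≥ D`: an empty point `y ∉ x` with
`dist y (x i) ≤ r` and `f_x(y) ≤ −D`. -/
def NearDeepHole (D r : ℝ) {N : ℕ} (x : Fin N → E3) (i : Fin N) : Prop :=
  ∃ y : E3, y ∉ Set.range x ∧ dist y (x i) ≤ r ∧ testEnergy x y ≤ -D

/-- HOLE-BLIND BUDGET(P₀) with dial `(D, r)`: at scale `(R, η)` only the `(R, η)`-bad sites that are NOT
within `r` of a hole of depth `≥ D` are priced. -/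
def Budget (D r : ℝ) (P₀ : PeriodicConfiguration 3) : Prop :=
  ∀ R η : ℝ, 0 < R → 0 < η → ∃ c : ℝ, 0 < c ∧
    ∀ (N : ℕ) (x : Fin N → E3), IsGroundState lennardJones x →
      c * (Nat.card {i : Fin N // ¬ LayeredGood R η x i ∧ ¬ NearDeepHole D r x i} : ℝ) ≤
        interactionEnergy lennardJones x - (N : ℝ) * P₀.energyPerParticle lennardJones

/-- Periodic windows along `x` (verbatim the conclusion of `ChessboardParticlePlanes.PeriodicWindows`). -/
def HasPeriodicWindows (x : (N : ℕ) → (Fin N → E3)) : Prop :=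
  ∃ P : PeriodicConfiguration 3, ∀ R ε : ℝ, 0 < ε → ∃ᶠ N in atTop, ∃ t : E3,
    (∀ s ∈ P.points, ‖s‖ ≤ R → ∃ i : Fin N, dist (x N i + t) s ≤ ε) ∧
    (∀ i : Fin N, ‖x N i + t‖ ≤ R → ∃ s ∈ P.points, dist (x N i + t) s ≤ ε)

/-- The graded family: FLOOR + the `(D, r)`-hole-blind budget force periodic windows along ground states. -/
def HoleRung (D r : ℝ) : Prop :=
  ∀ P₀ : PeriodicConfiguration 3, Floor P₀ → Budget D r P₀ →
    ∀ x : (N : ℕ) → (Fin N → E3), (∀ N, IsGroundState lennardJones (x N)) → HasPeriodicWindows x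

/-- **The banked candidate rung**: a certificate blind within distance `2` of every hole deeper than the
ground-state energy per particle `|e⋆|` already forces periodic windows along the ground states. -/
def HoleBlindRung : Prop := ∀ D : ℝ, -eStar < D → HoleRung D 2

/-! ## The soft structural lemmas (typed; §Softness) -/

/-- **Chemical-potential density** (proved below, `chemPotFrequentlyHigh`): for every `θ > 0`,
frequently in `n`, `E(n+1) − E(n) ≥ e⋆ − θ`. -/
def ChemPotFrequentlyHigh : Prop :=
  ∀ θ : ℝ, 0 < θ → ∃ᶠ n : ℕ in atTop,
    eStar - θ ≤ groundStateEnergy lennardJones 3 (n + 1) - groundStateEnergy lennardJones 3 n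

/-- **No deep holes, frequently** (follows from `ChemPotFrequentlyHigh`, `noDeepHoles_of`): for every
`θ > 0`, frequently in `n`, no `n`-particle Lennard-Jones ground state has an empty point where a test
particle would be bound by more than `|e⋆| + θ`. -/
def NoDeepHolesFrequently : Prop :=
  ∀ θ : ℝ, 0 < θ → ∃ᶠ n : ℕ in atTop, ∀ (x : Fin n → E3), IsGroundState lennardJones x →
    ∀ y : E3, y ∉ Set.range x → eStar - θ ≤ testEnergy x y

/-- **The floor's method along a frequent set of particle numbers** (proved below, `subsequenceFloor`:
the seed's proof with `eventually_exists_not_bad` read on `S`, then `spacing_selection` and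
`PeriodicGivenLayered_holds` unchanged): FLOOR + the full budget assumed only for `N ∈ S`, `S` hit
frequently, force periodic windows. -/
def SubsequenceFloor : Prop :=
  ∀ (P₀ : PeriodicConfiguration 3) (S : Set ℕ), (∃ᶠ n in atTop, n ∈ S) → Floor P₀ →
    (∀ R η : ℝ, 0 < R → 0 < η → ∃ c : ℝ, 0 < c ∧
      ∀ N ∈ S, ∀ (x : Fin N → E3), IsGroundState lennardJones x →
        c * (Nat.card {i : Fin N // ¬ LayeredGood R η x i} : ℝ) ≤
          interactionEnergy lennardJones x - (N : ℝ) * P₀.energyPerParticle lennardJones) →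
    ∀ x : (N : ℕ) → (Fin N → E3), (∀ N, IsGroundState lennardJones (x N)) → HasPeriodicWindows x

/-! ## Insertion stability (proved) -/

/-- Energy of the configuration with a test particle inserted: `E((y, x)) = E(x) + f_x(y)`. [folklore] -/
theorem interactionEnergy_cons {n : ℕ} (x : Fin n → E3) (y : E3) :
    interactionEnergy lennardJones (Fin.cons y x : Fin (n + 1) → E3) =
      interactionEnergy lennardJones x + testEnergy x y := by
  have h := Theorems.separationRemoval_interactionEnergy_succAbove lennardJones
    (Fin.cons y x : Fin (n + 1) → E3) 0
  have h0 : ((Fin.cons y x : Fin (n + 1) → E3) ∘ (0 : Fin (n + 1)).succAbove) = x := by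
    funext j
    simp only [Function.comp_apply, Fin.succAbove_zero, Fin.cons_succ]
  have hz : lennardJones 0 = 0 := by norm_num [lennardJones]
  have h1 : siteEnergy lennardJones (Fin.cons y x : Fin (n + 1) → E3) 0 = testEnergy x y := by
    rw [Theorems.separationRemoval_siteEnergy_eq_sum_sub, Fin.sum_univ_succ]
    simp only [Fin.cons_zero, Fin.cons_succ, dist_self, hz, testEnergy]
    ring
  rw [h, h0, h1]

/-- **Insertion stability**: for an `n`-particle ground state `x` and any empty point `y`,
`E(n+1) − E(n) ≤ f_x(y)`. [folklore] -/
theorem insertion_le {n : ℕ} {x : Fin n → E3} (hx : IsGroundState lennardJones x) {y : E3}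
    (hy : y ∉ Set.range x) :
    groundStateEnergy lennardJones 3 (n + 1) - groundStateEnergy lennardJones 3 n ≤ testEnergy x y := by
  have hinj : Function.Injective (Fin.cons y x : Fin (n + 1) → E3) :=
    Fin.cons_injective_of_injective hy hx.1
  have h1 := groundStateEnergy_lennardJones_le (d := 3) hinj
  rw [interactionEnergy_cons, hx.2] at h1
  linarith

/-- `ChemPotFrequentlyHigh → NoDeepHolesFrequently` (insertion into every ground state of the good sizes). -/
theorem noDeepHoles_of (h : ChemPotFrequentlyHigh) : NoDeepHolesFrequently := fun θ hθ =>
  (h θ hθ).mono fun _ hn _ hx _ hy => hn.trans (insertion_le hx hy)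

/-- **Chemical-potential density, PROVED** (telescoping `E(2N) − E(N)` against `2N·e⋆ ≤ E(2N)`
(`eStar_le_groundStateEnergy_div`) and `E(N) < N(e⋆ + θ/2)` eventually (`crysEnergyLimit`)). [folklore] -/
theorem chemPotFrequentlyHigh : ChemPotFrequentlyHigh := by
  intro θ hθ
  rw [Filter.frequently_atTop]
  intro N₀
  by_contra hcon
  push Not at hcon
  have hlim : Filter.Tendsto (fun N : ℕ => groundStateEnergy lennardJones 3 N / N) Filter.atTop
      (nhds eStar) :=
    Theorems.ChargedEnergyGapNegative.crysEnergyLimit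
  have hev : ∀ᶠ N : ℕ in Filter.atTop, groundStateEnergy lennardJones 3 N / N < eStar + θ / 2 :=
    hlim.eventually_lt_const (by linarith)
  obtain ⟨N₂, hN₂⟩ := Filter.eventually_atTop.1 hev
  obtain ⟨N, hN0, hN2, hN1⟩ : ∃ N : ℕ, N₀ ≤ N ∧ N₂ ≤ N ∧ 1 ≤ N :=
    ⟨max (max N₀ N₂) 1, le_trans (le_max_left _ _) (le_max_left _ _),
      le_trans (le_max_right _ _) (le_max_left _ _), le_max_right _ _⟩
  -- telescoping under the absurd hypothesis
  have htel : ∀ k : ℕ, groundStateEnergy lennardJones 3 (N + k) - groundStateEnergy lennardJones 3 N ≤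
      (k : ℝ) * (eStar - θ) := by
    intro k
    induction k with
    | zero => simp
    | succ k ih =>
      have h1 := hcon (N + k) (by omega)
      have hNk : N + (k + 1) = N + k + 1 := by omega
      rw [hNk]
      push_cast
      linarith
  have h2N := htel N
  -- the two landed bounds
  have hlow : ((N + N : ℕ) : ℝ) * eStar ≤ groundStateEnergy lennardJones 3 (N + N) := by
    have hpos : 0 < N + N := by omega
    have h := Theorems.ChargedEnergyGapNegative.eStar_le_groundStateEnergy_div hpos
    have hr : (0 : ℝ) < ((N + N : ℕ) : ℝ) := by exact_mod_cast hpos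
    rwa [le_div_iff₀ hr, mul_comm] at h
  have hup : groundStateEnergy lennardJones 3 N < (N : ℝ) * (eStar + θ / 2) := by
    have h := hN₂ N hN2
    have hr : (0 : ℝ) < (N : ℝ) := by exact_mod_cast hN1
    rw [div_lt_iff₀ hr] at h
    linarith
  push_cast at hlow
  have hr1 : (1 : ℝ) ≤ (N : ℝ) := by exact_mod_cast hN1
  have hNθ : 0 < (N : ℝ) * θ := mul_pos (by linarith) hθ
  linarith

/-- Hence **no deep holes, frequently** — PROVED. -/
theorem noDeepHolesFrequently : NoDeepHolesFrequently := noDeepHoles_of chemPotFrequentlyHigh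

/-! ## Dial monotonicity -/

theorem nearDeepHole_mono_radius {D r r' : ℝ} (h : r ≤ r') {N : ℕ} (x : Fin N → E3) (i : Fin N) :
    NearDeepHole D r x i → NearDeepHole D r' x i := by
  rintro ⟨y, hy, hyr, hyD⟩
  exact ⟨y, hy, hyr.trans h, hyD⟩

theorem nearDeepHole_anti_depth {D D' r : ℝ} (h : D ≤ D') {N : ℕ} (x : Fin N → E3) (i : Fin N) :
    NearDeepHole D' r x i → NearDeepHole D r x i := by
  rintro ⟨y, hy, hyr, hyD⟩
  exact ⟨y, hy, hyr, by linarith⟩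

/-- A budget pricing the larger set prices the smaller one. -/
theorem budget_of_subset {D D' r r' : ℝ} (P₀ : PeriodicConfiguration 3)
    (hsub : ∀ {N : ℕ} (x : Fin N → E3) (i : Fin N), NearDeepHole D r x i → NearDeepHole D' r' x i) :
    Budget D r P₀ → Budget D' r' P₀ := by
  classical
  intro hB R η hR hη
  obtain ⟨c, hc, hcB⟩ := hB R η hR hη
  refine ⟨c, hc, fun N x hx => le_trans ?_ (hcB N x hx)⟩
  have hle : Nat.card {i : Fin N // ¬ LayeredGood R η x i ∧ ¬ NearDeepHole D' r' x i} ≤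
      Nat.card {i : Fin N // ¬ LayeredGood R η x i ∧ ¬ NearDeepHole D r x i} := by
    rw [Nat.card_eq_fintype_card, Nat.card_eq_fintype_card]
    exact Fintype.card_subtype_mono _ _ fun i hi => ⟨hi.1, fun h => hi.2 (hsub x i h)⟩
  exact mul_le_mul_of_nonneg_left (by exact_mod_cast hle) hc.le

/-- `HoleRung` is ANTITONE in the radius: a larger blind radius un-prices more sites, the rung is stronger. -/
theorem holeRung_anti_radius {D r r' : ℝ} (h : r ≤ r') : HoleRung D r' → HoleRung D r :=
  fun H P₀ hF hB x hx => H P₀ hF (budget_of_subset P₀ (fun y i => nearDeepHole_mono_radius h y i) hB) x hx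

/-- `HoleRung` is MONOTONE in the depth threshold: a deeper threshold un-prices fewer sites. -/
theorem holeRung_mono_depth {D D' r : ℝ} (h : D ≤ D') : HoleRung D r → HoleRung D' r :=
  fun H P₀ hF hB x hx => H P₀ hF (budget_of_subset P₀ (fun y i => nearDeepHole_anti_depth h y i) hB) x hx

/-! ## F3 — the family at radius `r ≤ 0` is the proved floor -/

/-- With blind radius `r ≤ 0` no site is near a hole (the hole would sit ON the particle). -/
theorem not_nearDeepHole_of_nonpos {D r : ℝ} (hr : r ≤ 0) {N : ℕ} (x : Fin N → E3) (i : Fin N) :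
    ¬ NearDeepHole D r x i := by
  rintro ⟨y, hy, hyr, -⟩
  have h0 : dist y (x i) = 0 := le_antisymm (hyr.trans hr) dist_nonneg
  exact hy ⟨i, (dist_eq_zero.1 h0).symm⟩

/-- If no site of `x` is near a deep hole, the hole-blind count is the full defect count. -/
theorem card_eq_of_forall_not {D r R η : ℝ} {N : ℕ} (x : Fin N → E3)
    (hno : ∀ i : Fin N, ¬ NearDeepHole D r x i) :
    (Nat.card {i : Fin N // ¬ LayeredGood R η x i ∧ ¬ NearDeepHole D r x i} : ℝ) =
      Nat.card {i : Fin N // ¬ LayeredGood R η x i} := by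
  have hiff : ∀ i : Fin N, (¬ LayeredGood R η x i ∧ ¬ NearDeepHole D r x i) ↔ ¬ LayeredGood R η x i :=
    fun i => ⟨fun h => h.1, fun h => ⟨h, hno i⟩⟩
  exact_mod_cast Nat.card_congr (Equiv.subtypeEquivRight hiff)

/-- **F3.** `HoleRung D r` for `r ≤ 0` — every bad site priced — is the seed `FloorGivesLayered_proof`
followed by the proved `PeriodicGivenLayered_holds`. [folklore] -/
theorem holeRung_of_radius_nonpos {r : ℝ} (hr : r ≤ 0) (D : ℝ) : HoleRung D r := by
  intro P₀ hF hB x hx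
  refine Theses.FluxTubeKepler.PeriodicGivenLayered_holds x hx
    (Theorems.FluxTubeKeplerFloorGivesLayered.FloorGivesLayered_proof P₀ hF ?_ x hx)
  intro R η hR hη
  obtain ⟨c, hc, hcB⟩ := hB R η hR hη
  refine ⟨c, hc, fun N y hy => ?_⟩
  show c * (Nat.card {i : Fin N // ¬ LayeredGood R η y i} : ℝ) ≤ _
  rw [← card_eq_of_forall_not y (fun i => not_nearDeepHole_of_nonpos hr y i)]
  exact hcB N y hy

example : HoleRung 1 0 := holeRung_of_radius_nonpos le_rfl 1

/-- Every member of the family gives the floor value back. -/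
theorem holeRung_zero_of_holeRung {D r : ℝ} (hr : 0 ≤ r) (h : HoleRung D r) : HoleRung D 0 :=
  holeRung_anti_radius hr h

/-! ## The reduction to the soft lemmas (kernel-checked composition) -/

/-- **`HoleRung D r` for `D > −e⋆` is the floor's method plus `NoDeepHolesFrequently`.** -/
theorem holeRung_of (h1 : NoDeepHolesFrequently) (h2 : SubsequenceFloor) {D : ℝ} (hD : -eStar < D)
    (r : ℝ) : HoleRung D r := by
  intro P₀ hF hB x hx
  obtain ⟨θ, hθ, hθD⟩ : ∃ θ : ℝ, 0 < θ ∧ -D < eStar - θ :=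
    ⟨(D + eStar) / 2, by linarith, by linarith⟩
  let S : Set ℕ := {n | ∀ (x : Fin n → E3), IsGroundState lennardJones x →
    ∀ y : E3, y ∉ Set.range x → eStar - θ ≤ testEnergy x y}
  have hS : ∃ᶠ n in atTop, n ∈ S := h1 θ hθ
  refine h2 P₀ S hS hF ?_ x hx
  intro R η hR hη
  obtain ⟨c, hc, hcB⟩ := hB R η hR hη
  refine ⟨c, hc, fun N hN y hy => ?_⟩
  have hno : ∀ i : Fin N, ¬ NearDeepHole D r y i := by
    rintro i ⟨z, hz, -, hzD⟩
    have := hN y hy z hz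
    linarith
  rw [← card_eq_of_forall_not y hno]
  exact hcB N y hy

/-- Hence the banked candidate from the two soft lemmas. -/
theorem holeBlindRung_of (h1 : NoDeepHolesFrequently) (h2 : SubsequenceFloor) : HoleBlindRung :=
  fun _ hD => holeRung_of h1 h2 hD 2

theorem holeBlindRung_of_chemPot (h1 : ChemPotFrequentlyHigh) (h2 : SubsequenceFloor) : HoleBlindRung :=
  holeBlindRung_of (noDeepHoles_of h1) h2

/-! ## The floor's method along a frequent set of particle numbers (PROVED: the seed's proof with Step 1
read through `eventually_exists_not_bad` for the predicate `N ∈ S ∧ ¬ LayeredGood`, Steps 2–3 verbatim) -/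

/-- **`SubsequenceFloor` holds.** [folklore] -/
theorem subsequenceFloor : SubsequenceFloor := by
  intro P₀ S hS hE hD x hx
  classical
  refine Theses.FluxTubeKepler.PeriodicGivenLayered_holds x hx ?_
  -- Step 1': at every scale, FREQUENTLY in `N` (along `S`), some site of `x N` is layered-good
  have hgood : ∀ R η : ℝ, 0 < R → 0 < η → ∃ᶠ N in atTop, ∃ i : Fin N, ∃ a : ℝ, 47 / 50 ≤ a ∧ a ≤ 1 ∧
      ∃ (A : EuclideanSpace ℝ (Fin 3) →ₗᵢ[ℝ] EuclideanSpace ℝ (Fin 3)) (s : ℤ → ℤ) (z : ℤ → ℝ),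
        Literature.MathematicalPhysics.StatisticalMechanics.IsHaggSeq s ∧
        (∀ m : ℤ, 39 / 50 * a ≤ z (m + 1) - z m ∧ z (m + 1) - z m ≤ 17 / 20 * a) ∧
        let S : Set (EuclideanSpace ℝ (Fin 3)) := {p | ∃ m k l : ℤ, p = A (((k : ℝ) • Literature.MathematicalPhysics.StatisticalMechanics.triangularVec₁ a) + ((l : ℝ) • Literature.MathematicalPhysics.StatisticalMechanics.triangularVec₂ a) + ((Literature.MathematicalPhysics.StatisticalMechanics.haggLabel s m : ℝ) • Literature.MathematicalPhysics.StatisticalMechanics.barlowOffset a) + (z m • Literature.MathematicalPhysics.StatisticalMechanics.layerNormal 1))};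
        (∀ p ∈ S, ‖p‖ ≤ R → ∃ j : Fin N, dist (x N j - x N i) p ≤ η) ∧
        (∀ j : Fin N, ‖x N j - x N i‖ ≤ R → ∃ p ∈ S, dist (x N j - x N i) p ≤ η) := by
    intro R η hR hη
    obtain ⟨c, hc, hcN⟩ := hD R η hR hη
    have hcN' : ∀ (N : ℕ) (y : Fin N → EuclideanSpace ℝ (Fin 3)), IsGroundState lennardJones y →
        c * (Nat.card {i : Fin N // N ∈ S ∧ ¬ LayeredGood R η y i} : ℝ) ≤
          interactionEnergy lennardJones y - (N : ℝ) * P₀.energyPerParticle lennardJones := by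
      intro N y hy
      by_cases hNS : N ∈ S
      · have hiff : ∀ i : Fin N, (N ∈ S ∧ ¬ LayeredGood R η y i) ↔ ¬ LayeredGood R η y i :=
          fun i => ⟨fun h => h.2, fun h => ⟨hNS, h⟩⟩
        have hcard : (Nat.card {i : Fin N // N ∈ S ∧ ¬ LayeredGood R η y i} : ℝ) =
            Nat.card {i : Fin N // ¬ LayeredGood R η y i} := by
          exact_mod_cast Nat.card_congr (Equiv.subtypeEquivRight hiff)
        rw [hcard]
        exact hcN N hNS y hy
      · haveI : IsEmpty {i : Fin N // N ∈ S ∧ ¬ LayeredGood R η y i} := ⟨fun i => hNS i.2.1⟩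
        rw [Nat.card_of_isEmpty]
        have h0 := hE N y hy
        simp only [Nat.cast_zero, mul_zero]
        linarith
    have hev := eventually_exists_not_bad P₀ hE hc hcN'
    refine (hS.and_eventually hev).mono ?_
    rintro N ⟨hNS, hN⟩
    obtain ⟨i, hi⟩ := hN (x N) (hx N)
    have hLG : LayeredGood R η (x N) i := by
      by_contra h
      exact hi ⟨hNS, h⟩
    exact ⟨i, hLG⟩
  -- Step 2: one spacing for all scales, the transfer being dilation of the whole layered datum
  obtain ⟨a, ha1, ha2, hwin⟩ := spacing_selection hgood fun R ε hR hε => by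
    obtain ⟨η₁, hη₁0, hη₁ε, hη₁1⟩ : ∃ η₁ : ℝ, 0 < η₁ ∧ η₁ ≤ ε ∧ η₁ ≤ 1 :=
      ⟨min ε 1, lt_min hε one_pos, min_le_left _ _, min_le_right _ _⟩
    have hR1 : 0 < R + 1 := by linarith
    obtain ⟨θ, hθ0, hθR⟩ : ∃ θ : ℝ, 0 < θ ∧ θ * (R + 1) = η₁ / 2 :=
      ⟨η₁ / 2 / (R + 1), by positivity, by field_simp⟩
    refine ⟨47 / 50 * θ, by positivity, R + 1, η₁ / 2, by positivity, ?_⟩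
    intro a b R' η' ha hb hab hRR' hη' N i hG
    obtain ⟨A, s, z, hs, hbox, hM₁, hM₂⟩ := hG
    have ha0 : 0 < a := by linarith
    have hb0 : 0 < b := by linarith
    -- the dilation factor
    obtain ⟨ρ, hρ0, hρb⟩ : ∃ ρ : ℝ, 0 < ρ ∧ ρ * b = a :=
      ⟨a / b, div_pos ha0 hb0, div_mul_cancel₀ a hb0.ne'⟩
    have habs : |b - a| < 47 / 50 * θ := hab
    have h1ρ : |1 - ρ| ≤ θ := by
      have e1 : 1 - ρ = (b - a) / b := by rw [← hρb]; field_simp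
      rw [e1, abs_div, abs_of_pos hb0, div_le_iff₀ hb0]
      nlinarith [abs_nonneg (b - a)]
    have h1ρ' : |ρ⁻¹ - 1| ≤ θ := by
      have e1 : ρ⁻¹ - 1 = (b - a) / a := by rw [← hρb]; field_simp
      rw [e1, abs_div, abs_of_pos ha0, div_le_iff₀ ha0]
      nlinarith [abs_nonneg (b - a)]
    refine ⟨A, s, fun m => ρ * z m, hs, fun m => ?_, ?_⟩
    · -- the spacing box scales with `ρ`
      obtain ⟨hl, hu⟩ := hbox m
      have hl' := mul_le_mul_of_nonneg_left hl hρ0.le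
      have hu' := mul_le_mul_of_nonneg_left hu hρ0.le
      constructor
      · calc 39 / 50 * a = ρ * (39 / 50 * b) := by rw [← hρb]; ring
          _ ≤ ρ * (z (m + 1) - z m) := hl'
          _ = ρ * z (m + 1) - ρ * z m := by ring
      · calc ρ * z (m + 1) - ρ * z m = ρ * (z (m + 1) - z m) := by ring
          _ ≤ ρ * (17 / 20 * b) := hu'
          _ = 17 / 20 * a := by rw [← hρb]; ring
    · -- the two-way match at `(R, ε)` for the dilated set
      have hscale : ∀ m k l : ℤ, A (((k : ℝ) • triangularVec₁ a) + ((l : ℝ) • triangularVec₂ a) +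
          ((haggLabel s m : ℝ) • barlowOffset a) + ((ρ * z m) • layerNormal 1)) =
          ρ • A (((k : ℝ) • triangularVec₁ b) + ((l : ℝ) • triangularVec₂ b) +
          ((haggLabel s m : ℝ) • barlowOffset b) + (z m • layerNormal 1)) := by
        intro m k l
        rw [← hρb]
        exact layered_pt_scale A ρ b s z m k l
      dsimp only
      refine match_dilate (fun j => x N j - x N i) _ _ hθ0 hθR hη₁ε hη₁1 hρ0 h1ρ h1ρ' hRR' hη'
        ?_ ?_ hM₁ hM₂
      · rintro p ⟨m, k, l, rfl⟩
        exact ⟨m, k, l, (hscale m k l).symm⟩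
      · rintro p' ⟨m, k, l, rfl⟩
        exact ⟨_, ⟨m, k, l, rfl⟩, hscale m k l⟩
  -- Step 3: read the fixed-spacing good site at radius `max R 1` and translate by `t := -x N i`
  refine ⟨a, ha1, ha2, fun R ε hε => ?_⟩
  have hR' : 0 < max R 1 := lt_max_of_lt_right one_pos
  refine (hwin (max R 1) ε hR' hε).mono fun N hN => ?_
  obtain ⟨i, hi⟩ := hN
  obtain ⟨A, s, z, hs, hbox, hM₁, hM₂⟩ := hi
  refine ⟨A, -x N i, s, z, hs, hbox, ?_⟩
  have hsub : ∀ j : Fin N, x N j + -x N i = x N j - x N i := fun j =>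
    (sub_eq_add_neg (x N j) (x N i)).symm
  intro S
  refine ⟨fun p hp hpR => ?_, fun j hj => ?_⟩
  · obtain ⟨j, hj⟩ := hM₁ p hp (hpR.trans (le_max_left R 1))
    exact ⟨j, by rw [hsub j]; exact hj⟩
  · rw [hsub j] at hj ⊢
    exact hM₂ j (hj.trans (le_max_left R 1))

/-- **What remains**: `HoleBlindRung` is the floor's method along a frequent set of particle numbers
(`SubsequenceFloor`, the ONLY unproved piece) — every energetic input is proved above. -/
theorem holeBlindRung_of_subsequenceFloor (h : SubsequenceFloor) : HoleBlindRung :=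
  holeBlindRung_of noDeepHolesFrequently h

theorem holeRung_of_subsequenceFloor (h : SubsequenceFloor) {D : ℝ} (hD : -eStar < D) (r : ℝ) :
    HoleRung D r :=
  holeRung_of noDeepHolesFrequently h hD r

/-! ## THE RUNG IS A THEOREM -/

/-- **`HoleRung D r` holds for every depth threshold `D > −e⋆` and every blind radius `r`.** [folklore] -/
theorem holeRung_holds {D : ℝ} (hD : -eStar < D) (r : ℝ) : HoleRung D r :=
  holeRung_of noDeepHolesFrequently subsequenceFloor hD r

/-- **The banked candidate `HoleBlindRung` is PROVED** (FLOOR's method along the frequent set of particle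
numbers without deep holes + insertion stability + the chemical-potential density). [folklore] -/
theorem holeBlindRung_holds : HoleBlindRung :=
  holeBlindRung_of_subsequenceFloor subsequenceFloor

/-! ## F4 — on path: `Crystallization → HoleRung D r` -/

/-- ON-PATH: the sub-problem implies every member of the family (landed hull-criterion converse). -/
theorem holeRung_of_crystallization (D r : ℝ) (h : _root_.Crystallization) : HoleRung D r :=
  fun _ _ _ x hx =>
    Theorems.ChessboardParticlePlanesPeriodicWindowsIffCrystallization.periodicWindows_of_crystallization
      h x hx

/-- **F4 — `Crystallization → HoleBlindRung`.** -/
@[aesop safe apply]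
theorem HoleBlindRung_of_Crystallization (h : _root_.Crystallization) : HoleBlindRung :=
  fun D _ => holeRung_of_crystallization D 2 h

end Summit.AtomisticToContinuum.Crystallization.Cruxes.FluxCellKepler.HoleLadder
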